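import Literature.IUT.LogThetaLattice.ThetaPilotObjectsReal
import Literature.IUT.HodgeArakelov.SplittingMonoidRootConvention
import HarnessLib

/-!
# [IUTchIII] Definition 3.8 (i) over REAL objects, ROOT convention: splitting monoids generated by a `2l`-th
# root `q̲_v = q_v^{1/2l}` of the Tate parameter (abc-iut cell, layer L6 ↔ Cor. 3.12 crew; companion of
# `ThetaPilotObjectsReal.lean`)

S. Mochizuki, *Inter-universal Teichmüller theory III*, kurims manuscript (May 2020), §3, Definition 3.8 (i),
p. 112 [claim: Mochizuki2012, status: disputed] (Θ-pilot and q-pilot objects "determined by any collection, indexed by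
`v ∈ 𝕍^bad`, of generators up to torsion" of the splitting monoids; "determined by the `q_v`, for `v ∈ 𝕍^bad`
[cf. [IUTchI], Example 3.2, (iv)]"), read together with [IUTchI] Example 3.2 (iv) (kurims p. 71: the
splitting monoid at `v ∈ 𝕍^bad` is generated, modulo units/torsion, by a `2l`-th ROOT `q̲_v` of the
`q`-parameter) and [IUTchII] Remark 2.5.1 (i) / Corollary 3.5 (ii) (theta values `q̲_v^{j²}`); T. Dupuy,
A. Hilado, *The statement of Mochizuki's Corollary 3.12*, §3.3: `P_q = Σ_v ord_v(q̲_v)[v]`, `q̲_v = q_v^{1/2l}`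
[cite: DupuyHilado2025, §3.3].

`ThetaPilotObjectsReal.lean` instantiates abc-iut-L6-t4's Def. 3.8 (i) interfaces with the monoids generated by
the Tate parameter `τ_v = q_v` ITSELF and carries the `2l`-th root as the coefficient `1/2l` of the object-forming
maps (the `2l`-th-power shadow of the printed monoids; advisory A1 of abc-iut-L6-d3's audit, abc-iut-c312-5's
cross-check, cell finding R7-C5-F1/F1b). THIS file is the PRINTED convention: given, in addition to a Tate family
`τ`, explicit `2l`-th roots `ρ_v ∈ F_vˣ` with `ρ_v^{2l} = τ_v` (hypothesis `hρ`, used only where needed; such roots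
need not exist in `F_v` for arbitrary pilot data — they do at the M level, [IUTchI] Def. 3.1 (b)(c) — which is
why they are ARGUMENTS, exactly as in abc-iut-c312-5's `Real.splittingMonoidLGP X … v qroot ζ` /
`Real.valueProfile_pow_twoL (hroot)` of `Thm311RealTate.lean`, p408350):

* `QPilotData.dhRoot X ρ` — splitting monoids `μ_{2l} · ρ_v^ℕ ⊆ F_vˣ`, generators `ρ_v = q̲_v`, object-forming map
  `qObjOfRoot g := Σ_{v∈S} ord_v(g_v)·[v]` (NO `1/2l`); **`qPilotObject (QPilotData.dhRoot X ρ) = X.qPilot`** and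
  **`objOf g = X.qPilot` for every collection of generators up to torsion** (`qPilotObject_dhRoot`,
  `objOf_dhRoot_eq_qPilot`; `2l · ord_v(ρ_v) = ord_v(q_v)`, `ordv_root`);
* `SplittingMonoids.dhRoot X ρ ζ` — `μ_{2l}^{diag} · ξ_v^ℕ` for the printed value-profile
  `ξ_v = rootProfile = (ζ_{v,j} · ρ_v^{j²})_j = (ζ_{v,j} · q̲_v^{j²})_j`, the Θ-side map
  `thetaObjOfRoot X g := (Σ_{v∈S} ord_v(g_{v,j})·[v])_j` and **`thetaObjOfRoot X g = X.thetaPilot` for every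
  collection of generators up to torsion** (`thetaObjOfRoot_eq_thetaPilot`); the factorisation consequences
  `thetaPilotObject_eq_of_factors_root` / `thetaPilotObject_wellDefined_of_factors_root`;
* DICTIONARY with the `q_v`-convention file (via abc-iut-L6-t2's generic root-convention lemmas
  `valueProfileOf_eq_pow_of_pow_eq` / `gaussianSplittingMonoid_le_of_pow_eq`, `SplittingMonoidRootConvention.lean`
  p410045): `rootProfile_pow_twoL` — `ξ_v^{2l} = (τ_v^{j²})_j = tateProfile X τ 1` (c312-5's `valueProfile_pow_twoL`
  on the L6 side), hence the shadow monoid is a submonoid of the printed one,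
  `dh_Msplit_le_dhRoot : (SplittingMonoids.dh X τ 1).Msplit ≤ (SplittingMonoids.dhRoot X ρ ζ).Msplit`, and both
  conventions yield THE SAME pilot divisors `X.qPilot` / `X.thetaPilot` (the theorems above vs.
  `qPilotObject_dh` / `thetaObjOf_eq_thetaPilot`). For abc-iut-c312-5: `(SplittingMonoids.dhRoot X ρ ζ).Msplit v hv
  = gaussianSplittingMonoid F_vˣ (2l) (valueProfileOf ρ_v (labelNat²) ζ_v)` (`rfl`), i.e. (after `Units.val`)
  the monoid whose `tupleEmbed`-image is `Real.splittingMonoidLGP X … v ρ_v ζ_v` — same generator convention.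

Model-level bridge; elementary valuation bookkeeping over landed files; nothing here asserts a disputed claim or
takes a side on [IUTchIII] Cor. 3.12; typed ≠ discharged; instantiated ≠ endorsed.
-/

noncomputable section

namespace Literature.IUT.LogThetaLattice

open Literature.IUT.HodgeArakelov Literature.IUT.LogVolume NumberField IsDedekindDomain
open Literature.NumberTheory.EllipticCurves

universe u

section Root

variable {F : Type} [Field F] [NumberField F] (X : PilotData F)
variable (τ : ∀ v ∈ X.S, (v.adicCompletion F)ˣ)
  (hτ : ∀ v (hv : v ∈ X.S), ‖(τ v hv : v.adicCompletion F)‖ < 1 ∧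
    tateJ (τ v hv : v.adicCompletion F) = (X.jE : v.adicCompletion F))
variable (ρ : ∀ v ∈ X.S, (v.adicCompletion F)ˣ) (hρ : ∀ v (hv : v ∈ X.S), ρ v hv ^ (2 * X.l) = τ v hv)

include hτ hρ in
/-- **`2l · ord_v(q̲_v) = ord_v(q_v)`** for a `2l`-th root `ρ_v = q̲_v` of the Tate parameter (`X.ordq v` =
abc-iut-c312-3's `ord_v(q_v)`). [cite: DupuyHilado2025, §3.3] -/
theorem ordv_root (v : HeightOneSpectrum (𝓞 F)) (hv : v ∈ X.S) :
    (2 * X.l : ℕ) * CompletionModel.ordv F v (ρ v hv) = X.ordq v := by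
  rw [← ordv_pow, hρ v hv, ordv_tate X τ hτ v hv]

include hτ hρ in
/-- `ord_v(q̲_v) = ord_v(q_v)/2l` as real numbers — the coefficient of c312-3's `PilotData.qPilot` at `v`.
[cite: DupuyHilado2025, §3.3] -/
theorem ordv_root_real (v : HeightOneSpectrum (𝓞 F)) (hv : v ∈ X.S) :
    (CompletionModel.ordv F v (ρ v hv) : ℝ) = (X.ordq v : ℝ) / (2 * X.l) := by
  have h := ordv_root X τ hτ ρ hρ v hv
  have hl : (0 : ℝ) < 2 * X.l := X.two_mul_l_pos
  rw [eq_div_iff hl.ne', mul_comm]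
  exact_mod_cast h

include hτ hρ in
/-- The valuation does not kill a `2l`-th root of the Tate parameter (`ord_v(q_v) > 0`).
[cite: DupuyHilado2025, §3.3] -/
theorem ordvHom_root_ne_one (v : HeightOneSpectrum (𝓞 F)) (hv : v ∈ X.S) : ordvHom F v (ρ v hv) ≠ 1 := by
  rw [Ne, ordvHom_eq_one_iff]
  intro h0
  have h := ordv_root X τ hτ ρ hρ v hv
  rw [h0, mul_zero] at h
  exact (X.ordq_pos hv).ne' h.symm

/-- The q-side object-forming map in the ROOT convention: `(g_v)_{v∈S} ↦ Σ_{v∈S} ord_v(g_v)·[v]` (Dupuy–Hilado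
§3.3 `P_q = Σ_v ord_v(q̲_v)[v]`; no `1/2l`, the root being an honest element). [cite: DupuyHilado2025, §3.3] -/
def qObjOfRoot (g : ∀ v ∈ X.S, (v.adicCompletion F)ˣ) : FinDivisor F :=
  ∑ v ∈ X.S.attach, FinDivisor.of v.1 (CompletionModel.ordv F v.1 (g v.1 v.2) : ℝ)

/-- The Θ-side object-forming map in the ROOT convention: `(g_{v,j}) ↦ (Σ_{v∈S} ord_v(g_{v,j})·[v])_j`
(Dupuy–Hilado §3.3 `P_{Θ,j} = Σ_v ord_v(q̲_v^{j²})[v]`). [cite: DupuyHilado2025, §3.3] -/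
def thetaObjOfRoot (g : ∀ v ∈ X.S, Fin X.lstar → (v.adicCompletion F)ˣ) : LgpDivisor F X.lstar :=
  fun i => ∑ v ∈ X.S.attach, FinDivisor.of v.1 (CompletionModel.ordv F v.1 (g v.1 v.2 i) : ℝ)

/-- Re-indexing a sum over `S.attach` whose coefficients do not depend on the membership proof. [folklore] -/
private theorem sum_attach_of_eq' {c : ∀ v ∈ X.S, ℝ} {d : HeightOneSpectrum (𝓞 F) → ℝ}
    (h : ∀ v (hv : v ∈ X.S), c v hv = d v) :
    ∑ v ∈ X.S.attach, FinDivisor.of v.1 (c v.1 v.2) = ∑ v ∈ X.S, FinDivisor.of v (d v) := by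
  rw [← Finset.sum_attach X.S (fun v => FinDivisor.of v (d v))]
  exact Finset.sum_congr rfl fun v _ => by rw [h v.1 v.2]

/-- **The q-pilot data of Definition 3.8 (i), ROOT convention**: ambient monoids `F_vˣ`, splitting monoids
`μ_{2l} · q̲_v^ℕ` (abc-iut-L6-t2's `splittingMonoidAt F_vˣ 2l ρ_v 1`), distinguished generators the roots
`ρ_v = q̲_v` ([IUTchI] Ex. 3.2 (iv)), object-forming map `qObjOfRoot`. [claim: Mochizuki2012, status: disputed] -/
def QPilotData.dhRoot :
    QPilotData (FinDivisor F)
      (fun v (h : v ∈ X.S) => ↥(splittingMonoidAt ((v.adicCompletion F)ˣ) (2 * X.l) (ρ v h) 1)) :=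
  QPilotData.ofSplitting (V := HeightOneSpectrum (𝓞 F)) (isBad := (· ∈ X.S))
    (fun v (_ : v ∈ X.S) => (v.adicCompletion F)ˣ) (2 * X.l) (twoL_pos X) ρ
    (fun g => qObjOfRoot X fun v h => (g v h : (v.adicCompletion F)ˣ))

include hτ hρ in
/-- **`qPilotObject = P_q`** in the ROOT convention: the q-pilot object of `QPilotData.dhRoot X ρ` is c312-3's
`X.qPilot = Σ_v (ord_v(q_v)/2l)·[v] = Σ_v ord_v(q̲_v)·[v]`. [claim: Mochizuki2012, status: disputed] -/
theorem qPilotObject_dhRoot : qPilotObject (QPilotData.dhRoot X ρ) = X.qPilot := by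
  show qObjOfRoot X (fun v h => ρ v h) = X.qPilot
  unfold qObjOfRoot PilotData.qPilot
  exact sum_attach_of_eq' X (c := fun v hv => (CompletionModel.ordv F v (ρ v hv) : ℝ))
    (d := fun v => (X.ordq v : ℝ) / (2 * X.l)) fun v hv => ordv_root_real X τ hτ ρ hρ v hv

include hτ hρ in
/-- **"determined by ANY collection … of generators up to torsion"** ([IUTchIII] Def. 3.8 (i) p. 112), ROOT
convention, PROVED at the model: every collection of generators up to torsion of the `μ_{2l} · q̲_v^ℕ` forms the
same q-pilot divisor `X.qPilot`. [claim: Mochizuki2012, status: disputed] -/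
theorem objOf_dhRoot_eq_qPilot
    (g : ∀ v (h : v ∈ X.S), ↥(splittingMonoidAt ((v.adicCompletion F)ˣ) (2 * X.l) (ρ v h) 1))
    (hg : ∀ v h, IsGeneratorUpToTorsion (g v h)) : (QPilotData.dhRoot X ρ).objOf g = X.qPilot := by
  show qObjOfRoot X (fun v h => (g v h : (v.adicCompletion F)ˣ)) = X.qPilot
  unfold qObjOfRoot PilotData.qPilot
  refine sum_attach_of_eq' X
    (c := fun v hv => (CompletionModel.ordv F v (g v hv : (v.adicCompletion F)ˣ) : ℝ))
    (d := fun v => (X.ordq v : ℝ) / (2 * X.l)) fun v hv => ?_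
  obtain ⟨ζ, hζ, hgv⟩ := exists_eq_root_mul_of_isGeneratorUpToTorsion (ordvHom F v) (twoL_pos X)
    (ordvHom_root_ne_one X τ hτ ρ hρ v hv) (hg v hv)
  have hζ0 : CompletionModel.ordv F v (ζ : (v.adicCompletion F)ˣ) = 0 :=
    ordv_eq_zero_of_pow_eq_one F v (twoL_pos X) ((mem_rootsOfUnity' _ ζ).mp hζ)
  rw [hgv, ordv_mul, hζ0, zero_add, one_pow, pow_one, ordv_root_real X τ hτ ρ hρ v hv]

variable (ζ : ∀ v ∈ X.S, Fin X.lstar → ((v.adicCompletion F)ˣ)ˣ)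
  (hζ : ∀ v (hv : v ∈ X.S) (i : Fin X.lstar), ζ v hv i ∈ rootsOfUnity (2 * X.l) ((v.adicCompletion F)ˣ))

/-- **The printed value-profile** `ξ_v = (ζ_{v,j} · q̲_v^{j²})_{j ∈ 𝔽_l^⋇}` ([IUTchII] Rmk. 2.5.1 (i), Cor. 3.5 (ii);
abc-iut-L6-t2's `valueProfileOf ρ_v (j ↦ j²) ζ_v`), label `j = labelNat i`. [claim: Mochizuki2012, status: disputed] -/
def rootProfile (v : HeightOneSpectrum (𝓞 F)) (hv : v ∈ X.S) : Fin X.lstar → (v.adicCompletion F)ˣ :=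
  valueProfileOf (ρ v hv) (fun i => labelNat i ^ 2) (ζ v hv)

/-- Components of the printed value-profile: `ξ_{v,i} = ζ_{v,i} · q̲_v^{(i+1)²}`. [claim: Mochizuki2012, status: disputed] -/
@[simp] theorem rootProfile_apply (v : HeightOneSpectrum (𝓞 F)) (hv : v ∈ X.S) (i : Fin X.lstar) :
    rootProfile X ρ ζ v hv i = (ζ v hv i : (v.adicCompletion F)ˣ) * ρ v hv ^ labelNat i ^ 2 :=
  rfl

/-- **The splitting monoids `Ψ^⊥_{𝓕_lgp,v}` of Definition 3.8 (i), ROOT (= printed) convention**: at each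
`v ∈ S`, `μ_{2l}^{diag} · ξ_v^ℕ ⊆ ∏_j F_vˣ` for the printed value-profile `ξ_v = rootProfile` ([IUTchIII] Prop.
3.5 (ii)(c); [IUTchII] Cor. 3.5 (iii)). [claim: Mochizuki2012, status: disputed] -/
def SplittingMonoids.dhRoot :
    SplittingMonoids (fun v (_ : v ∈ X.S) => Fin X.lstar → (v.adicCompletion F)ˣ) :=
  SplittingMonoids.ofProfiles (V := HeightOneSpectrum (𝓞 F)) (isBad := (· ∈ X.S))
    (fun v (_ : v ∈ X.S) => (v.adicCompletion F)ˣ) (2 * X.l) (twoL_pos X) (rootProfile X ρ ζ)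

/-- The splitting monoid of `SplittingMonoids.dhRoot` at `v` is abc-iut-L6-t2's
`gaussianSplittingMonoid F_vˣ 2l (valueProfileOf ρ_v (labelNat²) ζ_v)` — the same generator convention as
abc-iut-c312-5's `Real.splittingMonoidLGP X … v qroot ζ`. [claim: Mochizuki2012, status: disputed] -/
theorem dhRoot_Msplit (v : HeightOneSpectrum (𝓞 F)) (hv : v ∈ X.S) :
    (SplittingMonoids.dhRoot X ρ ζ).Msplit v hv =
      gaussianSplittingMonoid ((v.adicCompletion F)ˣ) (2 * X.l)
        (valueProfileOf (ρ v hv) (fun i => labelNat i ^ 2) (ζ v hv)) :=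
  rfl

include hτ hρ hζ in
/-- `ord_v` of the printed value-profile, as a real number: `ord_v(ξ_{v,i}) = (i+1)² · ord_v(q_v) / 2l`.
[cite: DupuyHilado2025, §3.3] -/
theorem ordv_rootProfile (v : HeightOneSpectrum (𝓞 F)) (hv : v ∈ X.S) (i : Fin X.lstar) :
    (CompletionModel.ordv F v (rootProfile X ρ ζ v hv i) : ℝ) =
      ((labelNat i ^ 2 : ℕ) : ℝ) * (X.ordq v : ℝ) / (2 * X.l) := by
  have hζ0 : CompletionModel.ordv F v (ζ v hv i : (v.adicCompletion F)ˣ) = 0 :=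
    ordv_eq_zero_of_pow_eq_one F v (twoL_pos X) ((mem_rootsOfUnity' _ _).mp (hζ v hv i))
  rw [rootProfile_apply, ordv_mul, hζ0, zero_add, ordv_pow, Int.cast_mul, Int.cast_natCast,
    ordv_root_real X τ hτ ρ hρ v hv, mul_div_assoc]

include hτ hρ hζ in
/-- **"determined by ANY collection … of generators up to torsion"**, Θ-side, ROOT convention: every
collection of generators up to torsion of the printed `Ψ^⊥_v = μ_{2l}^{diag} · ξ_v^ℕ` forms c312-3's theta-pilot
divisor `X.thetaPilot = (Σ_v ((j²·ord_v(q_v))/2l)·[v])_j = (Σ_v ord_v(q̲_v^{j²})·[v])_j`.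
[claim: Mochizuki2012, status: disputed] -/
theorem thetaObjOfRoot_eq_thetaPilot (g : ∀ v (h : v ∈ X.S), ↥((SplittingMonoids.dhRoot X ρ ζ).Msplit v h))
    (hg : ∀ v h, IsGeneratorUpToTorsion (g v h)) :
    thetaObjOfRoot X (fun v h => (g v h : Fin X.lstar → (v.adicCompletion F)ˣ)) = X.thetaPilot := by
  funext i
  unfold thetaObjOfRoot PilotData.thetaPilot
  refine sum_attach_of_eq' X
    (c := fun v hv =>
      (CompletionModel.ordv F v ((g v hv : Fin X.lstar → (v.adicCompletion F)ˣ) i) : ℝ))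
    (d := fun v => (((i : ℕ) + 1 : ℝ) ^ 2) * (X.ordq v : ℝ) / (2 * X.l)) fun v hv => ?_
  have hl : 0 < X.lstar := lt_of_lt_of_le (by norm_num) X.two_le_lstar
  have hne : ordvHom F v (rootProfile X ρ ζ v hv ⟨0, hl⟩) ≠ 1 := by
    rw [Ne, ordvHom_eq_one_iff]
    intro h0
    have h := ordv_rootProfile X τ hτ ρ hρ ζ hζ v hv ⟨0, hl⟩
    rw [h0] at h
    have hq : (0 : ℝ) < X.ordq v := by exact_mod_cast X.ordq_pos hv
    have hl2 : (0 : ℝ) < 2 * X.l := X.two_mul_l_pos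
    simp only [labelNat] at h
    have : (0 : ℝ) < ((((0 : ℕ) + 1) ^ 2 : ℕ) : ℝ) * (X.ordq v : ℝ) / (2 * X.l) := by positivity
    rw [← h] at this
    simp at this
  obtain ⟨ω, hω, hgv⟩ := exists_eq_diag_mul_of_isGeneratorUpToTorsion (ordvHom F v) (twoL_pos X)
    (ξ := rootProfile X ρ ζ v hv) ⟨0, hl⟩ hne (g := g v hv) (hg v hv)
  have hω0 : CompletionModel.ordv F v (ω : (v.adicCompletion F)ˣ) = 0 :=
    ordv_eq_zero_of_pow_eq_one F v (twoL_pos X) ((mem_rootsOfUnity' _ ω).mp hω)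
  have hcomp : (g v hv : Fin X.lstar → (v.adicCompletion F)ˣ) i =
      (ω : (v.adicCompletion F)ˣ) * rootProfile X ρ ζ v hv i := by
    rw [show (g v hv : Fin X.lstar → (v.adicCompletion F)ˣ) = _ from hgv]
  rw [hcomp, ordv_mul, hω0, zero_add, ordv_rootProfile X τ hτ ρ hρ ζ hζ v hv i]
  simp only [labelNat]
  push_cast
  ring

/-! #### Dictionary with the `q_v`-convention file `ThetaPilotObjectsReal.lean` -/

include hρ hζ in
/-- **`ξ_v^{2l} = (q_v^{j²})_j`**: the `2l`-th power of the printed value-profile is the Tate-parameter profile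
with trivial torsion (`tateProfile X τ 1`; abc-iut-c312-5's `Real.valueProfile_pow_twoL` on the L6 side,
abc-iut-L6-t2's `valueProfileOf_pow_twoL`). [claim: Mochizuki2012, status: disputed] -/
theorem rootProfile_pow_twoL (v : HeightOneSpectrum (𝓞 F)) (hv : v ∈ X.S) :
    rootProfile X ρ ζ v hv ^ (2 * X.l) = tateProfile X τ (fun _ _ _ => 1) v hv :=
  (valueProfileOf_eq_pow_of_pow_eq (hρ v hv) (fun i => labelNat i ^ 2)
    (ζ := fun _ => 1) (ζ' := ζ v hv) fun i => ((mem_rootsOfUnity _ _).mp (hζ v hv i)).symm).symm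

include hρ hζ in
/-- The `q_v`-convention splitting monoid is a SUBMONOID of the printed one: `μ_{2l}^{diag} · (q_v^{j²})_j^ℕ ⊆
μ_{2l}^{diag} · (ζ_j q̲_v^{j²})_j^ℕ` (the `2l`-th-power shadow of advisory A1).
[claim: Mochizuki2012, status: disputed] -/
theorem dh_Msplit_le_dhRoot (v : HeightOneSpectrum (𝓞 F)) (hv : v ∈ X.S) :
    (SplittingMonoids.dh X τ (fun _ _ _ => 1)).Msplit v hv ≤ (SplittingMonoids.dhRoot X ρ ζ).Msplit v hv :=
  gaussianSplittingMonoid_le_of_pow_eq (hρ v hv) (fun i => labelNat i ^ 2) (ζ := fun _ => 1) (ζ' := ζ v hv)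
    fun i => ((mem_rootsOfUnity _ _).mp (hζ v hv i)).symm

/-! #### Consequences for the Θ-pilot object of a Prop. 3.7 signature, ROOT convention -/

variable {Frd : Type u} {IsoF : Frd → Frd → Type} {Ob : Frd → Type} {realify : Frd → Frd}
  {Strip : Type u} {IsoS : Strip → Strip → Type}
  (S : GlobalLGPFrobenioidSignature X.lstar (HeightOneSpectrum (𝓞 F)) (· ∈ X.S) Frd IsoF Ob realify
    Strip IsoS (fun v (_ : v ∈ X.S) => Fin X.lstar → (v.adicCompletion F)ˣ))
  (Φ : LgpDivisor F X.lstar → Ob S.Clgp) (hΦ : ∀ g, S.objOfLgp g = Φ (thetaObjOfRoot X g))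

include hτ hρ hζ hΦ in
/-- For any Prop. 3.7 signature over the monoids `∏_j F_vˣ` whose object-forming algorithm factors through
`thetaObjOfRoot`, the Θ-pilot object of Definition 3.8 (i) for the printed splitting monoids
`SplittingMonoids.dhRoot X ρ ζ` is `Φ(X.thetaPilot)`. [claim: Mochizuki2012, status: disputed] -/
theorem thetaPilotObject_eq_of_factors_root :
    thetaPilotObject S (SplittingMonoids.dhRoot X ρ ζ) = Φ X.thetaPilot := by
  unfold thetaPilotObject
  rw [hΦ, thetaObjOfRoot_eq_thetaPilot X τ hτ ρ hρ ζ hζ]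
  exact fun v h => Classical.choose_spec ((SplittingMonoids.dhRoot X ρ ζ).exists_gen v h)

include hτ hρ hζ hΦ in
/-- `thetaPilotObject_wellDefined` HOLDS for the printed splitting monoids under the same factorisation.
[claim: Mochizuki2012, status: disputed] -/
theorem thetaPilotObject_wellDefined_of_factors_root :
    thetaPilotObject_wellDefined S (SplittingMonoids.dhRoot X ρ ζ) := by
  intro g g' hg hg'
  rw [hΦ, hΦ, thetaObjOfRoot_eq_thetaPilot X τ hτ ρ hρ ζ hζ g hg,
    thetaObjOfRoot_eq_thetaPilot X τ hτ ρ hρ ζ hζ g' hg']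

end Root

end Literature.IUT.LogThetaLattice
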